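import Literature.MathematicalPhysics.QuantumFieldTheory.Balaban1983to89.B9Thm311DeltaPrimePos
import Literature.MathematicalPhysics.QuantumFieldTheory.Balaban1983to89.B9LocalGaugeZeroModesY
import Literature.MathematicalPhysics.QuantumFieldTheory.Balaban1983to89.B6SectAPoincare211V1

/-!
# `Balaban1983to89.B9Eq211PoincareAtLettersY` — T. Bałaban, *Propagators and renormalization transformations for lattice gauge theories. II*,
# Commun. Math. Phys. **96** (1984) 223–250 [Balaban1984PropagatorsII], (2.11) p. 225 «⟨λ, Δλ⟩ ≥ π² Σⱼ (Lʲη)⁻² Σ_{x∈Bʲ(Λⱼ)} η^d|λ(x)|², λ ∈ N(Q′)»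
# AT node00-def-Y's LETTERS, in the trace currency of the N06 rows: `π·⟨Λ,Λ⟩₁ ≤ ⟨D₁Λ, D₁Λ⟩₁` for every `M_N(ℂ)`-valued `Λ` with `Q′(1)Λ = 0`,
# `π = 8c_f²∕L^{2k}` — dag-n10-c's C3 (`B6SectAPoincare211V1.poincare211_V1`) through the chart (the (2.11) LETTER of the local road's W0 half)

statement-level skeleton of published theorems with citation tags; proofs where landed; nothing here is a claim about the Yang–Mills mass gap

THE PRINT (verbatim, [Balaban1984PropagatorsII] p. 225): *«⟨λ, Δλ⟩ ≥ π² Σ_{j=1}^k (Lʲη)^{−2} Σ_{x∈Bʲ(Λⱼ)} η^d|λ(x)|², λ ∈ N(Q′)»* (2.11); p. 227: *«Because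
Q′λ′ = 0 …»*.  [Balaban1985BackgroundPropagators] p. 395: *«It coincides with Δ_a in (2.19) of [4] if U = 1»* (the letters at `U = 1` are the lifts of the flat
kernels).

WHY THIS FILE (cell context, 2026-08-28).  The LOCAL centre number `m_□` of row 17's local road is reduced (this seat, `Summits/…/BalabanUVNodesN06Row17Local
CentreCoerciveReduction`) to three local letters at def-Y's letters; the (2.11)-shaped one is `π·⟨Λ,Λ⟩₁ ≤ ⟨D₁Λ, D₁Λ⟩₁` on the gauge functions `Λ` with
`Q′(1)Λ = 0`.  dag-n10-c's ROAD «C» station C3 PROVED (2.11) for r03∕p21's V1 model (`poincare211_V1`: `(8c²∕L^{2k})‖n‖² ≤ ‖∂n‖²` for every `n ∈ ker Q′`,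
all levels, no locality).  THIS FILE transports it through def-Y's chart (`B9LocalGaugeZeroModesY.inGauge_iff_qpK_mulVec_eq_zero`, `gradK_mulVec`,
`B6SectAOperatorsV1.mem_ker_QpE_iff`) and reads the `M_N(ℂ)` fibre entrywise (`QpY_one`, `gradY_one`, `liftMatY`):
* §1 `sum_sq_le_sum_sq_gradK_of_qpK` — (2.11) for REAL site functions on def-Y's box: `qpK·g = 0 ⟹ (8c_f²∕L^{2k})·Σ_z g(z)² ≤ Σ_b ((gradK·g)(b))²`;
* §2 ★★★ `poincare211_trIP_one_of_QpY` — **`Q′(1)Λ = 0 ⟹ (8c_f²∕L^{2k})·⟨Λ,Λ⟩₁ ≤ ⟨D₁Λ, D₁Λ⟩₁`** (`L = ℓ+1`, `k = i.k`, `D₁ = gradY i 1`, `Q′(1) = QpY i parSymY 1`)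
  — the (2.11) letter of `…LocalCentreCoerciveReduction.coer_trIP_padDeltaALocY_one_of_classes` for the class `𝒩 := N(Q′(1))` (support in `D` is then a
  separate, purely set-theoretic clause), with `π := 8c_f²∕L^{2k}` (print's normalisation `c_f = Lᵏ` gives `π = 8`).
HONEST SCOPE.  Transport of a landed kernel theorem (dag-n10-c C3) through def-Y's chart; the constant is C3's (top level `k`; the level-wise sharper form
`poincare211_levels_V1` is not transported here); nothing of [4] newly asserted; NOT a node discharge; count-neutral; one finite 𝕋⁴ programme — nothing about the
mass gap.  Cell `pub-ymgap` (D-0062), node N06 [B9] × N10 ROAD «C», seat `pub-ymgap-dag-n06-j` gen 24, 2026-08-28.  No `sorry`∕`axiom`∕`instance`∕`def`.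
-/

noncomputable section

namespace Literature.MathematicalPhysics.QuantumFieldTheory.Balaban1983to89.B9Eq211PoincareAtLettersY

open Literature.MathematicalPhysics.QuantumFieldTheory.Balaban1983to89
open Literature.MathematicalPhysics.QuantumFieldTheory.Balaban1983to89.Node00
open Literature.MathematicalPhysics.QuantumFieldTheory.Balaban1983to89.B6KLevelCensusIndexV1 (KIdx)
open Literature.MathematicalPhysics.QuantumFieldTheory.Balaban1983to89.B6GlobalChartV1 (PV boxEquiv domT)
open Literature.MathematicalPhysics.QuantumFieldTheory.Balaban1983to89.B6Ineq2133TwoScaleV1 (onFun onFun_apply)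
open Literature.MathematicalPhysics.QuantumFieldTheory.Balaban1983to89.B6SectAOperatorsV1 (dE QpE mem_ker_QpE_iff)
open Literature.MathematicalPhysics.QuantumFieldTheory.Balaban1983to89.B6SectAPoincare211V1 (poincare211_V1)
open Literature.MathematicalPhysics.QuantumFieldTheory.Balaban1983to89.B9LocalGaugeZeroModesY (inGauge_iff_qpK_mulVec_eq_zero)
open Literature.MathematicalPhysics.QuantumFieldTheory.Balaban1983to89.B9Thm311ReadingCoords (trIP)
open OpsYNablaBridge (chartY chartY_eq)
open scoped Matrix
open scoped Matrix.Norms.L2Operator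

variable {N : ℕ} {d ℓ : ℕ} {hd : 1 ≤ d + 1} {hL : Odd (ℓ + 1) ∧ 1 < ℓ + 1} {b₀ b₁ : ℝ} (i : KIdx d ℓ hd hL b₀ b₁)

/-! ## §1 (2.11) for real site functions on def-Y's box -/

/-- ★ **(2.11) FOR REAL SITE FUNCTIONS IN THE GAUGE SPACE, READ ON def-Y's BOX**: `qpK·g = 0 ⟹ (8c_f²∕L^{2k})·Σ_z g(z)² ≤ Σ_b ((gradK·g)(b))²` — C3's
`poincare211_V1` for `n := g ∘ chart` (`n ∈ ker Q′` by `inGauge_iff_qpK_mulVec_eq_zero` and `mem_ker_QpE_iff`; `‖n‖² = Σ_z g²` and `‖∂n‖² = Σ_b (gradK·g)²`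
by `gradK_mulVec`). [cite: Balaban1984PropagatorsII, (2.11) p.225; Balaban1983RegularityDecay, (2.27) p.580] -/
theorem sum_sq_le_sum_sq_gradK_of_qpK {g : SiteY i → ℝ} (hg : qpK i *ᵥ g = 0) :
    8 * i.cf ^ 2 / ((((ℓ + 1 : ℕ) : ℝ)) ^ i.k) ^ 2 * ∑ z, g z ^ 2 ≤ ∑ b, (gradK i *ᵥ g) b ^ 2 := by
  have hlam : (domT i.hN i.D i.hk).InGauge (fun x => g (chartY i x)) := (inGauge_iff_qpK_mulVec_eq_zero i g).2 hg
  have hn : (WithLp.toLp 2 (fun x => g (chartY i x)) : EuclideanSpace ℝ (Site (PV d ℓ i.m i.K hd hL) 0))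
      ∈ LinearMap.ker (QpE (domT i.hN i.D i.hk)) :=
    (mem_ker_QpE_iff (domT i.hN i.D i.hk) _).2 hlam
  have h := poincare211_V1 (domT i.hN i.D i.hk) i.cf hn
  have h1 : ‖(WithLp.toLp 2 (fun x => g (chartY i x)) : EuclideanSpace ℝ (Site (PV d ℓ i.m i.K hd hL) 0))‖ ^ 2 = ∑ z, g z ^ 2 := by
    rw [EuclideanSpace.real_norm_sq_eq]
    exact Fintype.sum_equiv (chartY i) _ _ (fun x => rfl)
  have h2 : ‖dE (P := PV d ℓ i.m i.K hd hL) i.cf (WithLp.toLp 2 (fun x => g (chartY i x)))‖ ^ 2 = ∑ b, (gradK i *ᵥ g) b ^ 2 := by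
    rw [EuclideanSpace.real_norm_sq_eq, gradK_mulVec]
    rfl
  rw [h1, h2] at h
  exact h

/-! ## §2 ★★★ The (2.11) letter in the trace currency at def-Y's letters -/

section Entries

variable {X Y : Type} [Fintype X]

/-- the real part of an entry of a lifted real kernel. [cite: Balaban1985BackgroundPropagators, p.395 («It coincides with Δ_a in (2.19) if U = 1»), bookkeeping] -/
private theorem re_liftMatY_apply' (M : Matrix Y X ℝ) (Φ : X → Matrix (Fin N) (Fin N) ℂ) (a b : Fin N) :
    (fun y => (liftMatY (Matrix (Fin N) (Fin N) ℂ) M Φ y a b).re) = M *ᵥ fun x => (Φ x a b).re := by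
  funext y
  rw [liftMatY_apply, Matrix.sum_apply, Complex.re_sum, Matrix.mulVec, dotProduct]
  exact Finset.sum_congr rfl fun x _ => by rw [Matrix.smul_apply, smul_eq_mul, Complex.re_ofReal_mul]

/-- the imaginary part of an entry of a lifted real kernel. [cite: Balaban1985BackgroundPropagators, p.395, bookkeeping] -/
private theorem im_liftMatY_apply' (M : Matrix Y X ℝ) (Φ : X → Matrix (Fin N) (Fin N) ℂ) (a b : Fin N) :
    (fun y => (liftMatY (Matrix (Fin N) (Fin N) ℂ) M Φ y a b).im) = M *ᵥ fun x => (Φ x a b).im := by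
  funext y
  rw [liftMatY_apply, Matrix.sum_apply, Complex.im_sum, Matrix.mulVec, dotProduct]
  exact Finset.sum_congr rfl fun x _ => by rw [Matrix.smul_apply, smul_eq_mul, Complex.im_ofReal_mul]

/-- the weight-1 trace norm as the sum of the squares of the real coordinates of the entries. [cite: Balaban1985BackgroundPropagators, p.393 (scalar products), bookkeeping] -/
private theorem trIP_one_self_eq_sum_entries' (Ψ : X → Matrix (Fin N) (Fin N) ℂ) :
    trIP (fun _ => (1 : ℝ)) Ψ Ψ = ∑ a : Fin N, ∑ b : Fin N, ((∑ s, (Ψ s a b).re ^ 2) + ∑ s, (Ψ s a b).im ^ 2) := by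
  unfold trIP
  simp only [one_mul]
  rw [Finset.sum_comm]
  refine Finset.sum_congr rfl fun a _ => ?_
  rw [Finset.sum_comm]
  refine Finset.sum_congr rfl fun b _ => ?_
  rw [← Finset.sum_add_distrib]
  refine Finset.sum_congr rfl fun s _ => ?_
  rw [Complex.star_def, Complex.mul_re, Complex.conj_re, Complex.conj_im]
  ring

end Entries

/-- ★★★ **(2.11) AT def-Y's LETTERS, TRACE CURRENCY**: for every `M_N(ℂ)`-valued site function `Λ` in the gauge space (`Q′(1)Λ = 0`),
**`(8c_f²∕L^{2k}) · ⟨Λ,Λ⟩₁ ≤ ⟨D₁Λ, D₁Λ⟩₁`** (`L = ℓ+1`, `k = i.k`) — the (2.11) letter of the local road's reduction for `𝒩 = N(Q′(1))`, from C3 entrywise.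
[cite: Balaban1984PropagatorsII, (2.11) p.225, p.227 («Because Q′λ′ = 0»); Balaban1985BackgroundPropagators, (3.3) p.390, (3.24) p.394, p.395 («if U = 1»)] -/
theorem poincare211_trIP_one_of_QpY {Λ : SiteY i → Matrix (Fin N) (Fin N) ℂ} (hQ : QpY i (parSymY i) (fun _ _ => 1) Λ = 0) :
    8 * i.cf ^ 2 / ((((ℓ + 1 : ℕ) : ℝ)) ^ i.k) ^ 2 * trIP (fun _ => (1 : ℝ)) Λ Λ ≤
      trIP (fun _ => (1 : ℝ)) (gradY i (fun _ _ => 1) Λ) (gradY i (fun _ _ => 1) Λ) := by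
  have hq : ∀ a b : Fin N, qpK i *ᵥ (fun z => (Λ z a b).re) = 0 ∧ qpK i *ᵥ (fun z => (Λ z a b).im) = 0 := by
    intro a b
    rw [QpY_one i (parSymY_one i)] at hQ
    exact ⟨by rw [← re_liftMatY_apply', hQ]; funext y; simp, by rw [← im_liftMatY_apply', hQ]; funext y; simp⟩
  rw [gradY_one, trIP_one_self_eq_sum_entries', trIP_one_self_eq_sum_entries', Finset.mul_sum]
  refine Finset.sum_le_sum fun a _ => ?_
  rw [Finset.mul_sum]
  refine Finset.sum_le_sum fun b _ => ?_
  have hre : (∑ z, (liftMatY (Matrix (Fin N) (Fin N) ℂ) (gradK i) Λ z a b).re ^ 2) = ∑ z, ((gradK i *ᵥ fun x => (Λ x a b).re) z) ^ 2 :=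
    Finset.sum_congr rfl fun z _ => by rw [← re_liftMatY_apply']
  have him : (∑ z, (liftMatY (Matrix (Fin N) (Fin N) ℂ) (gradK i) Λ z a b).im ^ 2) = ∑ z, ((gradK i *ᵥ fun x => (Λ x a b).im) z) ^ 2 :=
    Finset.sum_congr rfl fun z _ => by rw [← im_liftMatY_apply']
  rw [hre, him, mul_add]
  exact add_le_add (sum_sq_le_sum_sq_gradK_of_qpK i (hq a b).1) (sum_sq_le_sum_sq_gradK_of_qpK i (hq a b).2)

/-- the constant is positive. [cite: Balaban1984PropagatorsII, (2.11) p.225; folklore] -/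
theorem poincare211_const_pos : 0 < 8 * i.cf ^ 2 / ((((ℓ + 1 : ℕ) : ℝ)) ^ i.k) ^ 2 := by
  have hc : 0 < i.cf ^ 2 := sq_pos_iff.mpr i.hcf
  have hL : (0 : ℝ) < (((ℓ + 1 : ℕ) : ℝ)) ^ i.k := pow_pos (by exact_mod_cast Nat.succ_pos ℓ) _
  positivity

end Literature.MathematicalPhysics.QuantumFieldTheory.Balaban1983to89.B9Eq211PoincareAtLettersY

end
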